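import Summits.Ventures.LatticeQCDFlow.Exactness.IMHTauIntExact
import HarnessLib

/-!
# Weight-level masses of the flow sampler: clipped mass, rejection odds, upper mass (Tonelli)

HONEST FRAMING: exact (Metropolis-corrected) sampling algorithms for lattice gauge theory;
figures of merit are autocorrelation/cost numbers at stated couplings and volumes; no
continuum-physics claim.  (SCALAR calibration rung S0-A: not a gauge result.)

Venture `LatticeQCDFlow` (cell pub-lqcd), topic `Exactness`; FANOUT row 2 (`s0-phi4`, FLOW arm).
NEW WORK of the cell (elementary measure theory over Mathlib): the three functionals of the
importance weight `b = w/q` that control the closed-form `τ_int` of `IMHTauIntExact.lean`, and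
the inequalities between them used by `IMHTauIntFiniteOfWeightMoment.lean` (finite second weight
moment ⇒ finite `τ_int` for every bounded observable).  Nothing is cited as a fact.

## What is proved (`w, q > 0` measurable integrable, `∫ q = 1`, `Z = ∫ w`, `b = w/q`,
`λ = rejCurve`, CLIPPED MASS `M(v) = ∫ min(w, v q) dμ` (`= v(1 − λ(v))`, `mul_one_sub_rejCurve`),
strict lower mass `Π(u⁻) = massBelow`, UPPER MASS `Π̄(u) = ∫ 1[u ≤ b] w dμ`)

* `integrable_clip`, **`clip_pos`** (`M(v) > 0`), `clip_mono`, `clip_le` (`M ≤ Z`, `Π(v⁻) ≤ M(v)`);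
* **`rejOdds_le`** — for all `v, v₀ > 0`: `λ(v)/(1 − λ(v)) ≤ (v + v₀)/M(v₀)` (the rejection
  odds grow at most linearly in the weight);
* `integrable_upper_integrand`, `upperMass_eq` (`Π̄(u) = Z − Π(u⁻)`),
  **`abs_levelFun_le_upperMass`** — for a CENTRED bounded `g` (`∫ g w = 0`):
  `|∫ 1[b < u] g w| ≤ B Π̄(u)` (the level functional is the `g`-charge ABOVE the level);
* **`lintegral_upperMass`** — Tonelli: `∫_{u>0} Π̄(u) du = ∫ b w dμ` (Lebesgue integrals);
* **`integral_upperMass_sq_le`** — if `W₂ = ∫ b w dμ < ∞`: `Π̄ ∈ L¹(0,∞)` with integral `W₂`,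
  `Π̄² ∈ L¹(0,∞)` and `∫_{u>0} Π̄(u)² du ≤ Z W₂`.

Reading: `M(Z) = Z(1 − ‖q − w/Z‖_TV)` and `W₂/Z² = 1/(Kish ESS fraction)` — the quantities a
flow seat measures from i.i.d. model draws.  NOT CLAIMED: anything numerical.
-/

namespace Summit.Ventures.LatticeQCDFlow.Exactness

open Real MeasureTheory Filter Set Topology
open Summit.Ventures.LatticeQCDFlow.Scoring

variable {X : Type*} [MeasurableSpace X] {μ : Measure X} {w q : X → ℝ}

variable [SFinite μ]

/-! ## The clipped mass `M(v) = ∫ min(w, v q)` and the rejection odds -/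

omit [SFinite μ] in
/-- `0 ≤ min(w, v q) ≤ w` for `v ≥ 0`; integrability. -/
theorem integrable_clip (hw0 : ∀ t, 0 < w t) (hwm : Measurable w) (hwi : Integrable w μ)
    (hq0 : ∀ t, 0 < q t) (hqm : Measurable q) {v : ℝ} (hv : 0 ≤ v) :
    Integrable (fun z => min (w z) (v * q z)) μ
    ∧ (∀ z, 0 ≤ min (w z) (v * q z)) ∧ (∀ z, min (w z) (v * q z) ≤ w z) := by
  have h0 : ∀ z, 0 ≤ min (w z) (v * q z) := fun z =>
    le_min (hw0 z).le (mul_nonneg hv (hq0 z).le)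
  refine ⟨Integrable.mono' hwi (hwm.min (measurable_const.mul hqm)).aestronglyMeasurable
    (Eventually.of_forall fun z => ?_), h0, fun z => min_le_left _ _⟩
  rw [Real.norm_eq_abs, abs_of_nonneg (h0 z)]
  exact min_le_left _ _

omit [SFinite μ] in
/-- **`M(v) > 0`** for `v > 0` (`M(v) = v(1 − λ(v))` and `λ(v) < 1`). -/
theorem clip_pos (hw0 : ∀ t, 0 < w t) (hwm : Measurable w) (hq0 : ∀ t, 0 < q t)
    (hqm : Measurable q) (hqi : Integrable q μ) (hq1 : ∫ z, q z ∂μ = 1) {v : ℝ} (hv : 0 < v) :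
    0 < ∫ z, min (w z) (v * q z) ∂μ := by
  rw [← mul_one_sub_rejCurve hw0 hwm hq0 hqm hqi hq1 hv]
  exact mul_pos hv (sub_pos.2 (rejCurve_lt_one hw0 hwm hq0 hqm hqi hq1 hv))

omit [SFinite μ] in
/-- `M` is nondecreasing on `[0, ∞)`. -/
theorem clip_mono (hw0 : ∀ t, 0 < w t) (hwm : Measurable w) (hwi : Integrable w μ)
    (hq0 : ∀ t, 0 < q t) (hqm : Measurable q) {v v' : ℝ} (hv : 0 ≤ v) (hvv' : v ≤ v') :
    ∫ z, min (w z) (v * q z) ∂μ ≤ ∫ z, min (w z) (v' * q z) ∂μ := by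
  obtain ⟨hi, -, -⟩ := integrable_clip hw0 hwm hwi hq0 hqm hv
  obtain ⟨hi', -, -⟩ := integrable_clip hw0 hwm hwi hq0 hqm (hv.trans hvv')
  exact integral_mono hi hi' fun z =>
    min_le_min_left _ (mul_le_mul_of_nonneg_right hvv' (hq0 z).le)

omit [SFinite μ] in
/-- `M(v) ≤ Z` and `Π(v⁻) ≤ M(v)` (`v ≥ 0`): on `{b < v}` the clip is inactive. -/
theorem clip_le (hw0 : ∀ t, 0 < w t) (hwm : Measurable w) (hwi : Integrable w μ)
    (hq0 : ∀ t, 0 < q t) (hqm : Measurable q) {v : ℝ} (hv : 0 ≤ v) :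
    ∫ z, min (w z) (v * q z) ∂μ ≤ ∫ z, w z ∂μ
    ∧ massBelow μ w q v ≤ ∫ z, min (w z) (v * q z) ∂μ := by
  obtain ⟨hi, -, hle⟩ := integrable_clip hw0 hwm hwi hq0 hqm hv
  obtain ⟨iB, -⟩ := integrable_mass_integrands hw0 hwm hwi hqm v
  refine ⟨integral_mono hi hwi hle, ?_⟩
  unfold massBelow
  refine integral_mono iB hi fun z => ?_
  show (if w z / q z < v then w z else 0) ≤ min (w z) (v * q z)
  split_ifs with h
  · exact le_min le_rfl ((div_lt_iff₀ (hq0 z)).1 h).le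
  · exact le_min (hw0 z).le (mul_nonneg hv (hq0 z).le)

omit [SFinite μ] in
/-- **REJECTION ODDS BOUND**: for all `v, v₀ > 0`, `λ(v)/(1 − λ(v)) ≤ (v + v₀)/M(v₀)`
(`v ≥ v₀`: `1/(1−λ(v)) = v/M(v) ≤ v/M(v₀)`; `v < v₀`: odds are monotone, `≤ v₀/M(v₀)`). -/
theorem rejOdds_le (hw0 : ∀ t, 0 < w t) (hwm : Measurable w) (hwi : Integrable w μ)
    (hq0 : ∀ t, 0 < q t) (hqm : Measurable q) (hqi : Integrable q μ) (hq1 : ∫ z, q z ∂μ = 1)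
    {v₀ : ℝ} (hv₀ : 0 < v₀) {v : ℝ} (hv : 0 < v) :
    rejCurve μ w q v / (1 - rejCurve μ w q v) ≤ (v + v₀) / ∫ z, min (w z) (v₀ * q z) ∂μ := by
  have hm₀ := clip_pos hw0 hwm hq0 hqm hqi hq1 hv₀
  have hMv := mul_one_sub_rejCurve hw0 hwm hq0 hqm hqi hq1 hv
  have hMv₀ := mul_one_sub_rejCurve hw0 hwm hq0 hqm hqi hq1 hv₀
  have hl := fun {u : ℝ} (hu : 0 < u) =>
    (⟨(rejCurve_bounds hw0 hq0 hqi hu (μ := μ)).1, rejCurve_lt_one hw0 hwm hq0 hqm hqi hq1 hu⟩ :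
      0 ≤ rejCurve μ w q u ∧ rejCurve μ w q u < 1)
  obtain ⟨hl0, hl1⟩ := hl hv
  obtain ⟨hl0', hl1'⟩ := hl hv₀
  have h1 : 0 < 1 - rejCurve μ w q v := sub_pos.2 hl1
  have h1' : 0 < 1 - rejCurve μ w q v₀ := sub_pos.2 hl1'
  rcases le_or_gt v₀ v with hle | hlt
  · -- `v₀ ≤ v`: `λ/(1−λ) ≤ 1/(1−λ(v)) = v/M(v) ≤ v/M(v₀) ≤ (v+v₀)/M(v₀)`
    have hMle : ∫ z, min (w z) (v₀ * q z) ∂μ ≤ ∫ z, min (w z) (v * q z) ∂μ :=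
      clip_mono hw0 hwm hwi hq0 hqm hv₀.le hle
    calc rejCurve μ w q v / (1 - rejCurve μ w q v) ≤ 1 / (1 - rejCurve μ w q v) :=
          div_le_div_of_nonneg_right hl1.le h1.le
      _ = v / ∫ z, min (w z) (v * q z) ∂μ := by
          rw [← hMv]
          field_simp
      _ ≤ v / ∫ z, min (w z) (v₀ * q z) ∂μ := div_le_div_of_nonneg_left hv.le hm₀ hMle
      _ ≤ (v + v₀) / ∫ z, min (w z) (v₀ * q z) ∂μ :=
          div_le_div_of_nonneg_right (by linarith) hm₀.le
  · -- `v < v₀`: `λ(v) ≤ λ(v₀)` and `t ↦ t/(1−t)` is monotone on `[0,1)`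
    have hmono : rejCurve μ w q v ≤ rejCurve μ w q v₀ := rejCurve_mono hw0 hwm hq0 hqm hqi hv hlt.le
    calc rejCurve μ w q v / (1 - rejCurve μ w q v)
        ≤ rejCurve μ w q v₀ / (1 - rejCurve μ w q v₀) := by
          rw [div_le_div_iff₀ h1 h1']
          nlinarith
      _ ≤ 1 / (1 - rejCurve μ w q v₀) := div_le_div_of_nonneg_right hl1'.le h1'.le
      _ = v₀ / ∫ z, min (w z) (v₀ * q z) ∂μ := by
          rw [← hMv₀]
          field_simp
      _ ≤ (v + v₀) / ∫ z, min (w z) (v₀ * q z) ∂μ :=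
          div_le_div_of_nonneg_right (by linarith) hm₀.le

/-! ## The upper mass `Π̄(u) = ∫ 1[u ≤ b] w` and the level functional of a centred observable -/

omit [SFinite μ] in
/-- Integrability, bounds and measurability of the upper-mass integrand `1[u ≤ b] g w`. -/
theorem integrable_upper_integrand (hw0 : ∀ t, 0 < w t) (hwm : Measurable w)
    (hwi : Integrable w μ) (hqm : Measurable q) {g : X → ℝ} (hgm : Measurable g) {B : ℝ}
    (hgb : ∀ t, |g t| ≤ B) (u : ℝ) :
    Integrable (fun x => (if u ≤ w x / q x then g x * w x else 0 : ℝ)) μ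
    ∧ ∀ x, |(if u ≤ w x / q x then g x * w x else 0 : ℝ)| ≤ B * (if u ≤ w x / q x then w x else 0) := by
  have hpt : ∀ x, |(if u ≤ w x / q x then g x * w x else 0 : ℝ)|
      ≤ B * (if u ≤ w x / q x then w x else 0) := fun x => by
    split_ifs
    · rw [abs_mul, abs_of_pos (hw0 x)]
      exact mul_le_mul_of_nonneg_right (hgb x) (hw0 x).le
    · rw [abs_zero, mul_zero]
  refine ⟨Integrable.mono' (hwi.const_mul B) ((Measurable.ite (measurableSet_le measurable_const
    (hwm.div hqm)) (hgm.mul hwm) measurable_const).aestronglyMeasurable)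
    (Eventually.of_forall fun x => ?_), hpt⟩
  rw [Real.norm_eq_abs]
  refine (hpt x).trans ?_
  have hB : 0 ≤ B := (abs_nonneg _).trans (hgb x)
  split_ifs
  · exact le_rfl
  · rw [mul_zero]; exact mul_nonneg hB (hw0 x).le

omit [SFinite μ] in
/-- **`Π̄(u) = Z − Π(u⁻)`**, hence `0 ≤ Π̄ ≤ Z`. -/
theorem upperMass_eq (hw0 : ∀ t, 0 < w t) (hwm : Measurable w) (hwi : Integrable w μ)
    (hqm : Measurable q) (u : ℝ) :
    ∫ x, (if u ≤ w x / q x then w x else 0) ∂μ = (∫ x, w x ∂μ) - massBelow μ w q u := by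
  obtain ⟨iB, -⟩ := integrable_mass_integrands hw0 hwm hwi hqm u
  unfold massBelow
  rw [← integral_sub hwi iB]
  refine integral_congr_ae (Eventually.of_forall fun x => ?_)
  show (if u ≤ w x / q x then w x else 0) = w x - (if w x / q x < u then w x else 0)
  by_cases h : u ≤ w x / q x
  · rw [if_pos h, if_neg (not_lt.2 h), sub_zero]
  · rw [if_neg h, if_pos (not_le.1 h), sub_self]

omit [SFinite μ] in
/-- **Centred observables: `G(u) = −∫ 1[u ≤ b] g w`**, hence `|G(u)| ≤ B Π̄(u)`. -/
theorem abs_levelFun_le_upperMass (hw0 : ∀ t, 0 < w t) (hwm : Measurable w)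
    (hwi : Integrable w μ) (hqm : Measurable q) {g : X → ℝ} (hgm : Measurable g) {B : ℝ}
    (hgb : ∀ t, |g t| ≤ B) (hg0 : ∫ x, g x * w x ∂μ = 0) (u : ℝ) :
    |∫ x, (if w x / q x < u then g x * w x else 0) ∂μ|
      ≤ B * ∫ x, (if u ≤ w x / q x then w x else 0) ∂μ := by
  obtain ⟨iU, hpt⟩ := integrable_upper_integrand hw0 hwm hwi hqm hgm hgb u
  have hgw : Integrable (fun x => g x * w x) μ := by
    refine Integrable.mono' (hwi.const_mul B) (hgm.mul hwm).aestronglyMeasurable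
      (Eventually.of_forall fun x => ?_)
    rw [Real.norm_eq_abs, abs_mul, abs_of_pos (hw0 x)]
    exact mul_le_mul_of_nonneg_right (hgb x) (hw0 x).le
  have e : ∫ x, (if w x / q x < u then g x * w x else 0) ∂μ
      = (∫ x, g x * w x ∂μ) - ∫ x, (if u ≤ w x / q x then g x * w x else 0) ∂μ := by
    rw [← integral_sub hgw iU]
    refine integral_congr_ae (Eventually.of_forall fun x => ?_)
    show (if w x / q x < u then g x * w x else 0) = g x * w x - (if u ≤ w x / q x then g x * w x else 0)
    by_cases h : w x / q x < u
    · rw [if_pos h, if_neg (not_le.2 h), sub_zero]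
    · rw [if_neg h, if_pos (not_lt.1 h), sub_self]
  have iW : Integrable (fun x => (if u ≤ w x / q x then w x else 0 : ℝ)) μ := by
    refine Integrable.mono' hwi ((Measurable.ite (measurableSet_le measurable_const (hwm.div hqm))
      hwm measurable_const).aestronglyMeasurable) (Eventually.of_forall fun x => ?_)
    rw [Real.norm_eq_abs]
    split_ifs
    · rw [abs_of_pos (hw0 x)]
    · rw [abs_zero]; exact (hw0 x).le
  rw [e, hg0, zero_sub, abs_neg, ← integral_const_mul]
  exact abs_integral_le_integral_abs.trans (integral_mono_of_nonneg
    (Eventually.of_forall fun x => abs_nonneg _) (iW.const_mul B) (Eventually.of_forall hpt))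

/-- **TONELLI FOR THE UPPER MASS**: `∫_{u>0} Π̄(u) du = ∫ b w dμ` as Lebesgue integrals
(`∫_{u>0} 1[u ≤ b(x)] du = b(x)`). -/
theorem lintegral_upperMass (hw0 : ∀ t, 0 < w t) (hwm : Measurable w) (hwi : Integrable w μ)
    (hq0 : ∀ t, 0 < q t) (hqm : Measurable q) :
    ∫⁻ u in Ioi (0:ℝ), ENNReal.ofReal (∫ x, (if u ≤ w x / q x then w x else 0) ∂μ)
      = ∫⁻ x, ENNReal.ofReal (w x / q x * w x) ∂μ := by
  have hbm : Measurable fun x => w x / q x := hwm.div hqm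
  have hb0 : ∀ x, 0 < w x / q x := fun x => div_pos (hw0 x) (hq0 x)
  set F : ℝ → X → ENNReal := fun u x => ENNReal.ofReal (if u ≤ w x / q x then w x else 0) with hF
  have hFm : Measurable (Function.uncurry F) :=
    (Measurable.ite (measurableSet_le measurable_fst (hbm.comp measurable_snd))
      (hwm.comp measurable_snd) measurable_const).ennreal_ofReal
  -- inner real integral as a Lebesgue integral
  have hinner : ∀ u, ENNReal.ofReal (∫ x, (if u ≤ w x / q x then w x else 0) ∂μ)
      = ∫⁻ x, F u x ∂μ := by
    intro u
    have iW : Integrable (fun x => (if u ≤ w x / q x then w x else 0 : ℝ)) μ := by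
      refine Integrable.mono' hwi ((Measurable.ite (measurableSet_le measurable_const hbm)
        hwm measurable_const).aestronglyMeasurable) (Eventually.of_forall fun x => ?_)
      rw [Real.norm_eq_abs]
      split_ifs
      · rw [abs_of_pos (hw0 x)]
      · rw [abs_zero]; exact (hw0 x).le
    exact ofReal_integral_eq_lintegral_ofReal iW (Eventually.of_forall fun x => by
      dsimp only; split_ifs; exacts [(hw0 x).le, le_rfl])
  simp_rw [hinner]
  rw [lintegral_lintegral_swap (hFm.aemeasurable (μ := (volume.restrict (Ioi (0:ℝ))).prod μ))]
  refine lintegral_congr fun x => ?_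
  -- `∫_{u>0} 1[u ≤ b] w du = w · b`
  have e : (fun u => F u x) = (Iic (w x / q x)).indicator (fun _ => ENNReal.ofReal (w x)) := by
    funext u
    simp only [hF, Set.indicator_apply, Set.mem_Iic]
    split_ifs <;> simp
  rw [e, lintegral_indicator measurableSet_Iic, setLIntegral_const, Measure.restrict_apply
    measurableSet_Iic, Iic_inter_Ioi, Real.volume_Ioc, sub_zero,
    ← ENNReal.ofReal_mul (hw0 x).le]
  congr 1
  ring

/-- Under a finite second weight moment the upper mass is integrable on `(0, ∞)` with
`∫_{u>0} Π̄ du = ∫ b w dμ`, and **`∫_{u>0} Π̄(u)² du ≤ Z ∫ b w dμ`**. -/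
theorem integral_upperMass_sq_le (hw0 : ∀ t, 0 < w t) (hwm : Measurable w) (hwi : Integrable w μ)
    (hq0 : ∀ t, 0 < q t) (hqm : Measurable q) (hW₂ : Integrable (fun x => w x / q x * w x) μ) :
    IntegrableOn (fun u : ℝ => ∫ x, (if u ≤ w x / q x then w x else 0) ∂μ) (Ioi 0)
    ∧ (∫ u in Ioi (0:ℝ), ∫ x, (if u ≤ w x / q x then w x else 0) ∂μ) = ∫ x, w x / q x * w x ∂μ
    ∧ IntegrableOn (fun u : ℝ => (∫ x, (if u ≤ w x / q x then w x else 0) ∂μ) ^ 2) (Ioi 0)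
    ∧ (∫ u in Ioi (0:ℝ), (∫ x, (if u ≤ w x / q x then w x else 0) ∂μ) ^ 2)
        ≤ (∫ x, w x ∂μ) * ∫ x, w x / q x * w x ∂μ := by
  set P : ℝ → ℝ := fun u => ∫ x, (if u ≤ w x / q x then w x else 0) ∂μ with hP
  set Z : ℝ := ∫ x, w x ∂μ with hZ
  have hPeq : ∀ u, P u = Z - massBelow μ w q u := fun u => upperMass_eq hw0 hwm hwi hqm u
  have hP0 : ∀ u, 0 ≤ P u := fun u => by
    rw [hPeq]; obtain ⟨-, h1, h2⟩ := massBelow_bounds hw0 hwm hwi hqm u (μ := μ); linarith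
  have hPZ : ∀ u, P u ≤ Z := fun u => by
    rw [hPeq]; have h := (massBelow_bounds hw0 hwm hwi hqm u (μ := μ)).1; linarith
  have hPm : Measurable P := by
    have e : P = fun u => Z - massBelow μ w q u := funext hPeq
    rw [e]
    exact measurable_const.sub (massBelow_mono hw0 hwm hwi hqm).measurable
  have hbw0 : ∀ x, 0 ≤ w x / q x * w x := fun x =>
    mul_nonneg (div_nonneg (hw0 x).le (hq0 x).le) (hw0 x).le
  have hL : ∫⁻ u in Ioi (0:ℝ), ENNReal.ofReal (P u) = ENNReal.ofReal (∫ x, w x / q x * w x ∂μ) := by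
    rw [hP, lintegral_upperMass hw0 hwm hwi hq0 hqm,
      ofReal_integral_eq_lintegral_ofReal hW₂ (Eventually.of_forall hbw0)]
  have hPi : IntegrableOn P (Ioi 0) := by
    refine (lintegral_ofReal_ne_top_iff_integrable hPm.aestronglyMeasurable
      (Eventually.of_forall hP0)).1 ?_
    rw [hL]
    exact ENNReal.ofReal_ne_top
  have hPint : ∫ u in Ioi (0:ℝ), P u = ∫ x, w x / q x * w x ∂μ := by
    rw [integral_eq_lintegral_of_nonneg_ae (Eventually.of_forall hP0) hPm.aestronglyMeasurable, hL,
      ENNReal.toReal_ofReal (integral_nonneg hbw0)]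
  have hP2i : IntegrableOn (fun u => P u ^ 2) (Ioi 0) := by
    refine Integrable.mono' (hPi.const_mul Z) (hPm.pow_const 2).aestronglyMeasurable
      (Eventually.of_forall fun u => ?_)
    rw [Real.norm_eq_abs, abs_of_nonneg (sq_nonneg _), sq]
    exact mul_le_mul_of_nonneg_right (hPZ u) (hP0 u)
  refine ⟨hPi, hPint, hP2i, ?_⟩
  calc ∫ u in Ioi (0:ℝ), P u ^ 2 ≤ ∫ u in Ioi (0:ℝ), Z * P u := by
        refine integral_mono hP2i (hPi.const_mul Z) fun u => ?_
        show P u ^ 2 ≤ Z * P u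
        rw [sq]; exact mul_le_mul_of_nonneg_right (hPZ u) (hP0 u)
    _ = Z * ∫ x, w x / q x * w x ∂μ := by rw [integral_const_mul, hPint]

end Summit.Ventures.LatticeQCDFlow.Exactness
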